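import Literature.Computability.AlgebraicComplexity.SchoenhageTau
import HarnessLib

/-!
# Discharge of `Blaser2013_lemma64` (Bläser 2013, Lemma 6.4: border rank to rank)

Topic `Literature/Computability/AlgebraicComplexity`. This sibling file of `SchoenhageTau.lean`
PROVES the named fact `Blaser2013_lemma64` of that file:

> **Lemma 6.4.** There is a constant `c_h` such that for all `t`: `R(t) ≤ c_h R_h(t)`. `c_h`
> depends polynomially on `h`, in particular `c_h ≤ C(h+2, 2)`.

The proof is the printed one (Bläser 2013, p. 28): write `u_ρ = ∑_α ε^α u_{ρα}`,
`v_ρ = ∑_β ε^β v_{ρβ}`, `w_ρ = ∑_γ ε^γ w_{ργ}`; the left-hand side of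
`∑_ρ u_ρ ⊗ v_ρ ⊗ w_ρ = ε^h t + O(ε^{h+1})` is `∑_ρ ∑_{α,β,γ} ε^{α+β+γ} u_{ρα} ⊗ v_{ρβ} ⊗ w_{ργ}`,
so comparing the coefficients of `ε^h`, `t` is the sum of all `u_{ρα} ⊗ v_{ρβ} ⊗ w_{ργ}` with
`α + β + γ = h` — `C(h+2, 2)` triads for each of the `r` products of the approximate computation
(`tensorRank_le_choose_mul_of_isApproxDecomposition`, valid over any commutative semiring and any
index types). For finite formats `R_h(t)` is attained (`exists_isApproxDecomposition`), which
gives `R(t) ≤ C(h+2, 2) · R_h(t)` (`tensorRank_le_choose_mul_approxRank`) and the fact with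
`c_h = C(h+2, 2)` (`Blaser2013_lemma64_holds`). Remark 6.5 (`c_h = 1 + 2h` over infinite fields)
is not needed and not formalised.

## References

* M. Bläser, *Fast Matrix Multiplication*, Theory of Computing Library, Graduate Surveys 5
  (2013), 1–60, doi:10.4086/toc.gs.2013.005 (held: `paper:doi-10-4086-toc-gs-2013-005`):
  Def. 6.1 (p. 26), Lemma 6.4 and its proof (p. 28). [Blaser2013]
-/

noncomputable section

open scoped BigOperators Polynomial

namespace Literature.Computability.AlgebraicComplexity

universe u v₁ v₂ v₃

variable {K : Type u} [CommSemiring K] {ι : Type v₁} {κ : Type v₂} {μ : Type v₃}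

/-- `∑_{k=0}^{h} (k+1) = C(h+2, 2)` (the number of triples `(α, β, γ) ∈ ℕ³` with
`α + β + γ = h`, counted by `γ = h - k`, `α + β = k`). [folklore] -/
private theorem sum_range_succ_add_one_eq_choose (h : ℕ) :
    ∑ k ∈ Finset.range (h + 1), (k + 1) = (h + 2).choose 2 := by
  have e := Finset.sum_range_succ' (fun i => i) (h + 1)
  rw [add_zero] at e
  rw [← e, Finset.sum_range_id, Nat.choose_two_right]

/-- The triples `α + β + γ = h`, listed as `⟨(α + β, γ), (α, β)⟩`, number `C(h+2, 2)` ("it is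
sufficient to compute `C(h+2, 2)` products for each product in the approximate computation").
[cite: Blaser2013, Lemma 6.4 (proof)] -/
private theorem card_antidiagonal_sigma_antidiagonal (h : ℕ) :
    ((Finset.antidiagonal h).sigma fun x => Finset.antidiagonal x.1).card = (h + 2).choose 2 := by
  rw [Finset.card_sigma]
  simp only [Finset.Nat.card_antidiagonal]
  rw [Finset.Nat.sum_antidiagonal_eq_sum_range_succ (fun a _ => a + 1) h]
  exact sum_range_succ_add_one_eq_choose h

/-- **Bläser 2013, Lemma 6.4 (content of the proof)**: an approximate decomposition of order `h`
with `r` triads over `K[ε]` yields an exact decomposition of `t` into `C(h+2, 2) · r` triads —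
the `ε^h`-coefficient of `u_ρ ⊗ v_ρ ⊗ w_ρ` is `∑_{α+β+γ=h} u_{ρα} ⊗ v_{ρβ} ⊗ w_{ργ}` — hence
`R(t) ≤ C(h+2, 2) · r` (any commutative semiring, any index types).
[cite: Blaser2013, Lemma 6.4] -/
theorem tensorRank_le_choose_mul_of_isApproxDecomposition {h : ℕ} {t : ι → κ → μ → K} {r : ℕ}
    {u : Fin r → ι → K[X]} {v : Fin r → κ → K[X]} {w : Fin r → μ → K[X]}
    (huvw : IsApproxDecomposition h t u v w) : tensorRank t ≤ (h + 2).choose 2 * r := by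
  classical
  -- entrywise coefficient comparison in degree `h`
  have key : ∀ a b c, t a b c = ∑ ρ, ∑ p ∈ (Finset.antidiagonal h).sigma
      (fun x => Finset.antidiagonal x.1),
        (u ρ a).coeff p.2.1 * (v ρ b).coeff p.2.2 * (w ρ c).coeff p.1.2 := by
    intro a b c
    have e := huvw a b c h le_rfl
    rw [if_pos rfl] at e
    rw [← e, Polynomial.finsetSum_coeff]
    refine Finset.sum_congr rfl fun ρ _ => ?_
    rw [Polynomial.coeff_mul, Finset.sum_sigma]
    refine Finset.sum_congr rfl fun x _ => ?_
    rw [Polynomial.coeff_mul, Finset.sum_mul]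
  -- hence `t` is a sum of triads indexed by the finite type `Fin r × S`
  set S := (Finset.antidiagonal h).sigma fun x => Finset.antidiagonal x.1 with hS
  have hsum : t = ∑ s : Fin r × S, triad (fun a => (u s.1 a).coeff s.2.1.2.1)
      (fun b => (v s.1 b).coeff s.2.1.2.2) (fun c => (w s.1 c).coeff s.2.1.1.2) := by
    funext a b c
    rw [key a b c, Finset.sum_apply, Finset.sum_apply, Finset.sum_apply, Fintype.sum_prod_type]
    refine Finset.sum_congr rfl fun ρ _ => ?_
    rw [← Finset.sum_coe_sort S]
    simp only [triad_apply]
  calc tensorRank t ≤ Fintype.card (Fin r × S) := tensorRank_le_card_of_eq_sum _ _ _ hsum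
    _ = (h + 2).choose 2 * r := by
      rw [Fintype.card_prod, Fintype.card_fin, Fintype.card_coe, hS,
        card_antidiagonal_sigma_antidiagonal, mul_comm]

/-- **Bläser 2013, Lemma 6.4** for finite formats, with the explicit constant:
`R(t) ≤ C(h+2, 2) · R_h(t)` (`R_h(t)` is attained over finite index types).
[cite: Blaser2013, Lemma 6.4] -/
theorem tensorRank_le_choose_mul_approxRank [Fintype ι] [Fintype κ] [Fintype μ] [DecidableEq ι]
    [DecidableEq κ] [DecidableEq μ] (h : ℕ) (t : ι → κ → μ → K) :
    tensorRank t ≤ (h + 2).choose 2 * approxRank h t := by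
  obtain ⟨u, v, w, huvw⟩ := Nat.sInf_mem (s := {r : ℕ | ∃ (u : Fin r → ι → K[X])
    (v : Fin r → κ → K[X]) (w : Fin r → μ → K[X]), IsApproxDecomposition h t u v w})
    (exists_isApproxDecomposition h t)
  exact tensorRank_le_choose_mul_of_isApproxDecomposition huvw

/-- **Bläser 2013, Lemma 6.4** holds, with `c_h = C(h+2, 2)` (Bläser's bound; over infinite
fields `c_h = 1 + 2h` also works, Remark 6.5, not needed here). [cite: Blaser2013, Lemma 6.4] -/
theorem Blaser2013_lemma64_holds : Blaser2013_lemma64.{u} := by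
  intro K _ h
  exact ⟨(h + 2).choose 2, le_rfl, fun t => tensorRank_le_choose_mul_approxRank h t⟩

end Literature.Computability.AlgebraicComplexity

end
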